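import Mathlib
import Literature.MathematicalPhysics.QuantumFieldTheory.Balaban1983to89.Beta.OneLoop
import Literature.MathematicalPhysics.QuantumFieldTheory.Balaban1983to89.Beta.ConstraintElimination

/-!
# `Balaban1983to89.Beta.KKTBridge` — β sub-cell, Stage 0 kernel node: BRIDGE THEOREMS between the bordered (KKT)
# normalisation `logZ` of the constrained Gaussian (1.4) and B9's reduced normalisation `logZred` (3.157), over the
# landed definitions of `Beta.OneLoop` / `Beta.ConstraintElimination` — nondegeneracy and sign of the bordered determinant
# under `Regular`, the exact Jacobian in basis-free Gram form, basis independence, the background-independence criterion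
# for `Π⁰`, and the dictionary `|det Q_κ|² = det(QQᵀ)/det(CᵀC)` with the adapted-coordinates Jacobian

HONEST FRAMING (BETA-SPEC.md, verbatim): discharging `BetaPertH` makes Bałaban's UV stability UNCONDITIONAL — a real
constructive-QFT result; it is NOT the continuum limit and NOT the Clay problem.  THIS MODULE ASSERTS NOTHING about the
series and nothing about β: every declaration is a kernel-checked theorem of finite-dimensional real linear algebra (or
of elementary calculus) about the cell's OWN definitions `Beta.ConstrainedGaussian.{kkt, logZ, reduced, logZred, Regular}`,
`Beta.Family`, `Beta.polarization`, `Beta.hessianAt` (tree `Beta/OneLoop.lean`, pv25: p177267 088f5ebc826b, v1.1 p177309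
4d0d92268dd2, v1.2 p177369 cb33f72977a1) and `Beta.ConstrainedGaussian.{constraintRetained, constraintEliminated, elimMatrix}`,
`Beta.ConstraintElimination.{det_bordered_mul_det_basis_sq, constraint_mul_elim, elim_mulVec_inl}` (tree
`Beta/ConstraintElimination.lean`, pv03-g3: p177421 c476afa5a254), which are IMPORTED AND USED BY NAME, never restated.
No `def` at all: theorems only.  Value = kernel bridge theorems behind a definitional point of the flow-input sub-cell
(OBJECTS.md v2.4 §4 / §5(a), GAPS G-beta-1, C-beta-6, C-pv03-6), NOT summit progress.

CITATION HEADER (lean-in-tree rule 2026-08-18; CONTEXT ONLY — nothing of either paper is restated as a fact).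
T. Bałaban, *Renormalization group approach to lattice gauge field theories. I. Generation of effective actions in a small
field approximation and a coupling constant renormalization in four dimensions*, Commun. Math. Phys. **109**, 249–301 (1987)
[Balaban1987RG1] (cell paper B12; held `paper:balaban1987-cmp109-rg-i-small-field`; journal page = PDF page + 248):
(1.4) p. 260 «Z^{(j)}(U_k) = ∫ dB δ(Q̃B) exp[−½⟨B, Δ^{(j)}(U_k)B⟩]» (the δ-constrained Gaussian normalisation), p. 267
«LQ̃h = I», p. 268 «B′ = CB, C is the operator determined by the configuration V^{(k)}».  T. Bałaban, *Propagators for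
lattice gauge theories in a background field*, Commun. Math. Phys. **99**, 389–434 (1985) [Balaban1985BackgroundPropagators]
(cell paper B9; journal page = PDF page + 388): (3.157)–(3.158) p. 428 «B = CB̃ … (Z′^{(k)}(Λ))^{−1} ∫ dB̃ exp[−½⟨B̃, C*Δ_k CB̃⟩
+ ⟨B̃, C*g⟩] … (C*Δ_kC)^{−1} = C̃^{(k)}(Λ)», «a positive definite operator C*Δ_kC».  The quotations were read on the x2 page
renders held by the cell (transcripts `HOME/b2b-balaban-pv25/transcript-BETA0.md`, `HOME/BETA/OBJECTS.md` §2/§10); they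
MOTIVATE the two closed forms compared below and are the dictionary of OBJECTS.md §4 — they are not used as hypotheses or
conclusions anywhere in this file.

WHAT THIS MODULE DOES (audit cell `pub-balaban`, β sub-cell, unit `b2b-balaban-pv23` gen 2, journal claim
BETA-0-KKTDET-KERNEL 17:53:17Z, RE-SCOPED by the owner's split — pv25 NOTE 17:56:25Z, pv03-g3 NOTE 17:57:52Z, pv23 NOTE
18:01:47Z, pv03-g3 NOTE 18:07:51Z: the DETERMINANT IDENTITY itself — adapted and general-basis forms — is pv03-g3's
`Beta/ConstraintElimination` (landed); the Gaussian INTEGRAL is pv16's `Beta/GaussianIntegral`; THIS file holds the bridge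
theorems over the landed objects and consumes pv03-g3's identity by name).  Notation: `K := [[Δ, Qᵀ], [Q, 0]]`
(`ConstrainedGaussian.kkt`), `C` ANY `n × r` real matrix with `Q·C = 0` and `r + m = n` (a kernel parametrisation when
injective), `a := det(CᵀC)`, `g := det(QQᵀ)`, `d := det(CᵀΔC) = det (reduced C)`.
* §1 THE GRAM FORM, unconditional over `ℝ` (`det_gram_mul_det_kkt`, any finite index types with `e : ν ⊕ ι ≃ κ`; over the
  landed structure `det_gram_mul_kkt_det`):  `a · det K = (−1)^m · g · d`.  Nondegenerate direction = the `Z := C, Y := Qᵀ`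
  instance of `ConstraintElimination.det_bordered_mul_det_basis_sq` together with `det[C | Qᵀ]² = a·g`
  (`det_fromCols_transpose_sq`); degenerate direction `g = 0 ⇒ det K = 0` (`det_kkt_eq_zero_of_det_gram_eq_zero`).  Hence
  `log|det K| = log g + log d − log a` (`log_abs_det_kkt`), `det K ≠ 0 ↔ d ≠ 0` given `a, g ≠ 0` (`kkt_det_ne_zero_iff`),
  and BASIS INDEPENDENCE `d₁·a₂ = d₂·a₁` for two kernel parametrisations as soon as `g ≠ 0` (`det_reduced_mul_det_gram_eq`,
  `det_reduced_mul_det_gram_eq'`): `d/a` does not depend on the parametrisation.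
* §2 UNDER `Regular` (Q onto, Δ symmetric, Δ > 0 on ker Q — the side conditions of `Beta.OneLoop`): (a) `det K ≠ 0`
  (`kkt_det_ne_zero`, directly: `ker K = 0`); an injective kernel parametrisation with `r = n − m` exists (rank–nullity,
  `exists_kernelBasis`); `CᵀC`, `QQᵀ`, `CᵀΔC` are positive definite (`gram_posDef`, `constraintGram_posDef`,
  `reduced_posDef`); (c) the SIGN `0 < (−1)^m · det K`, `|det K| = (−1)^m det K` (`neg_one_pow_mul_kkt_det_pos`, `abs_kkt_det`).
* §3 THE EXACT JACOBIAN, basis-free (pv25's (b); lead NOTE 17:45:57Z «the const is (Z/Z′)(U) = the Jacobian»):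
  `logZ = logZred C + ½·log a − ½·log g` whenever `a, g, d ≠ 0` (`logZ_eq_logZred_add`; the `(2π)`-prefactors agree
  because `r = n − m`), in particular under `Regular` for EVERY injective kernel parametrisation
  (`logZ_eq_logZred_add_of_regular`).  The correction depends on `(Q, C)` and NOT on `Δ`.
* §4 CONSEQUENCE FOR THE POLARIZATION (OBJECTS.md §5(a) / GAPS G-beta-1 made precise): for a background family `F` whose
  CONSTRAINT DOES NOT MOVE (`(F B).Q = Q₀` for all `B`) and a fixed kernel parametrisation `C` of `Q₀`:
  `F.logZ = F.logZred C + const` (`family_logZ_eq_logZred_add_const`; near `0` under eventual regularity,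
  `family_logZ_eventuallyEq_of_regular`), hence `polarization F i j = hessianAt (F.logZred C) i j` for all `i, j`
  (`polarization_eq_hessianAt_logZred`; under the `OneLoopDictionary` v1.2-shaped hypothesis `∀ᶠ B in 𝓝 0, (F B).Regular`:
  `polarization_eq_hessianAt_logZred_of_regular`) and `ContDiffAt ℝ k F.logZ 0 ↔ ContDiffAt ℝ k (F.logZred C) 0`
  (`contDiffAt_logZ_iff_logZred_of_regular`) — no differentiability is assumed for the Hessian statement
  (`iteratedFDeriv ℝ 2 (f + const) = iteratedFDeriv ℝ 2 f` identically).  When `Q̃` DOES move with the background, the term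
  `½·log det(C(B)ᵀC(B)) − ½·log det(Q(B)Q(B)ᵀ)` is `B`-dependent in general and the bordered form (equivalently pv03-g3's
  local factor `|det Q_κ(U)|`) must be kept — this file decides nothing about which case Bałaban's averaging operators fall
  in (rows an1/an2).
* §5 DICTIONARY WITH pv03-g3's ADAPTED-COORDINATES JACOBIAN: for Bałaban's `C = Z.elimMatrix e` (adapted splitting `e`,
  `det Q_κ ≠ 0`): `Q·C = 0` in the original coordinates (`Q_mul_elimMatrix`), `C` injective (`elimMatrix_mulVec_injective`),
  and `det(CᵀC)·(det Q_κ)² = det(QQᵀ)` (`det_gram_elimMatrix_mul_sq`), i.e. `log|det Q_κ| = ½·log g − ½·log a`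
  (`log_abs_det_constraintEliminated_eq`): the local Jacobian of `ConstrainedGaussian.logZ_eq_logZred_sub_log` and the
  Gram Jacobian of §3 are the same number.

ABSOLUTE RULE.  No internally-minted statement enters as a cited fact: there are no cited facts here at all — every
declaration is proved in this file from Mathlib and the tree modules `Beta/OneLoop.lean`, `Beta/ConstraintElimination.lean`;
the manuscripts' disputed steps are not used.  Companion prose: `run/shared/lean/pub/pub-balaban/b2b-balaban-pv23/KKT-BRIDGE.md`;
GAPS row C-pv23-2.
-/

namespace Literature.MathematicalPhysics.QuantumFieldTheory.Balaban1983to89.Beta.KKTBridge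

open Matrix

/-! ## §1. The Gram form over `ℝ` (unconditional), its logarithm, nondegeneracy, basis independence -/

section Real

variable {κ ν ι : Type*} [Fintype κ] [Fintype ν] [Fintype ι] [DecidableEq κ] [DecidableEq ν] [DecidableEq ι]

omit [Fintype ν] [DecidableEq ν] in
/-- Over `ℝ`, a singular constraint Gram matrix `QQᵀ` forces the bordered matrix to be singular: a nonzero `v` with
`QQᵀv = 0` has `Qᵀv = 0` (`‖Qᵀv‖² = 0`), and then `[[Δ,Qᵀ],[Q,0]]·(0,v) = 0`. [folklore] -/
theorem det_kkt_eq_zero_of_det_gram_eq_zero (Δ : Matrix κ κ ℝ) (Q : Matrix ι κ ℝ) (h : (Q * Qᵀ).det = 0) :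
    (fromBlocks Δ Qᵀ Q 0).det = 0 := by
  obtain ⟨v, hv0, hv⟩ := Matrix.exists_mulVec_eq_zero_iff.mpr h
  have hQv : Qᵀ *ᵥ v = 0 := by
    have h2 : v ⬝ᵥ ((Q * Qᵀ) *ᵥ v) = 0 := by rw [hv, dotProduct_zero]
    rw [← mulVec_mulVec, dotProduct_mulVec, ← mulVec_transpose] at h2
    exact dotProduct_self_eq_zero.mp h2
  apply Matrix.exists_mulVec_eq_zero_iff.mp
  refine ⟨Sum.elim 0 v, ?_, ?_⟩
  · intro hc
    apply hv0
    funext i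
    have := congrFun hc (Sum.inr i)
    simpa using this
  · rw [fromBlocks_mulVec]
    ext (i | i) <;> simp [hQv]

omit [Fintype κ] [Fintype ν] [Fintype ι] [DecidableEq κ] [DecidableEq ν] [DecidableEq ι] in
/-- Block matrices re-indexed blockwise: `(fromBlocks A B C D).submatrix (Sum.map e₁ e₂) (Sum.map e₃ e₄)` is the block
matrix of the re-indexed blocks. [folklore] -/
private theorem fromBlocks_submatrix_sum_map {α : Type*} {ν' ι' : Type*} (A : Matrix ν ν α) (B : Matrix ν ι α)
    (C : Matrix ι ν α) (D : Matrix ι ι α) (e₁ : ν' → ν) (e₂ : ι' → ι) :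
    (fromBlocks A B C D).submatrix (Sum.map e₁ e₂) (Sum.map e₁ e₂) =
      fromBlocks (A.submatrix e₁ e₁) (B.submatrix e₁ e₂) (C.submatrix e₂ e₁) (D.submatrix e₂ e₂) := by
  ext (i | i) (j | j) <;> rfl

/-- Gram factorisation of the change of variables `[C | Qᵀ]` when `QC = 0`:  `det[C | Qᵀ]² = det(CᵀC)·det(QQᵀ)`
(`[C | Qᵀ]ᵀ[C | Qᵀ] = diag(CᵀC, QQᵀ)`). [folklore] -/
theorem det_fromCols_transpose_sq (Q : Matrix ι (ν ⊕ ι) ℝ) (C : Matrix (ν ⊕ ι) ν ℝ) (hQC : Q * C = 0) :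
    (fromCols C Qᵀ).det ^ 2 = (Cᵀ * C).det * (Q * Qᵀ).det := by
  have h1 : Cᵀ * Qᵀ = 0 := by rw [← transpose_mul, hQC, transpose_zero]
  have : (fromCols C Qᵀ)ᵀ * fromCols C Qᵀ = fromBlocks (Cᵀ * C) 0 0 (Q * Qᵀ) := by
    rw [transpose_fromCols, transpose_transpose, fromRows_mul_fromCols, hQC, h1]
  calc (fromCols C Qᵀ).det ^ 2 = ((fromCols C Qᵀ)ᵀ * fromCols C Qᵀ).det := by
          rw [det_mul, det_transpose, sq]
    _ = (Cᵀ * C).det * (Q * Qᵀ).det := by rw [this, det_fromBlocks_zero₂₁]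

/-- The `ν ⊕ ι`-indexed Gram form (transport-free core of `det_gram_mul_det_kkt`): the `Z := C`, `Y := Qᵀ` instance
of pv03-g3's general-basis identity `ConstraintElimination.det_bordered_mul_det_basis_sq` (consumed BY NAME — one owner
per statement), combined with `det_fromCols_transpose_sq` and, in the degenerate direction `det(QQᵀ) = 0`, with
`det_kkt_eq_zero_of_det_gram_eq_zero`. [folklore] -/
private theorem det_gram_mul_det_kkt_sum (Δ : Matrix (ν ⊕ ι) (ν ⊕ ι) ℝ) (Q : Matrix ι (ν ⊕ ι) ℝ)
    (C : Matrix (ν ⊕ ι) ν ℝ) (hQC : Q * C = 0) :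
    (Cᵀ * C).det * (fromBlocks Δ Qᵀ Q 0).det =
      (-1) ^ Fintype.card ι * (Q * Qᵀ).det * (Cᵀ * Δ * C).det := by
  by_cases hg : (Q * Qᵀ).det = 0
  · rw [det_kkt_eq_zero_of_det_gram_eq_zero Δ Q hg, hg]
    ring
  · have h := ConstraintElimination.det_bordered_mul_det_basis_sq Δ Q C Qᵀ hQC (isUnit_iff_ne_zero.mpr hg)
    rw [det_fromCols_transpose_sq Q C hQC] at h
    apply mul_right_cancel₀ hg
    calc (Cᵀ * C).det * (fromBlocks Δ Qᵀ Q 0).det * (Q * Qᵀ).det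
        = (fromBlocks Δ Qᵀ Q 0).det * ((Cᵀ * C).det * (Q * Qᵀ).det) := by ring
      _ = (-1) ^ Fintype.card ι * (Cᵀ * Δ * C).det * (Q * Qᵀ).det ^ 2 := h
      _ = (-1) ^ Fintype.card ι * (Q * Qᵀ).det * (Cᵀ * Δ * C).det * (Q * Qᵀ).det := by ring

/-- **THE GRAM FORM of the bordered-determinant identity over `ℝ`, unconditional.**  For finite index types with
`e : ν ⊕ ι ≃ κ` (so `|ν| + |ι| = |κ|`), a quadratic form `Δ` on `κ`, a constraint matrix `Q : ι × κ` and ANY `C : κ × ν`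
with `Q·C = 0`:  `det(CᵀC) · det [[Δ, Qᵀ],[Q, 0]] = (−1)^{|ι|} · det(QQᵀ) · det(CᵀΔC)`.  (Both sides vanish when `QQᵀ` is
singular or `C` is not injective; for `C` an injective kernel parametrisation and `Q` onto it expresses `|det K|` as
`det(QQᵀ)·det(CᵀΔC)/det(CᵀC)`.)  This is the `Y = Qᵀ` instance of `ConstraintElimination.det_bordered_mul_det_basis_sq`. [folklore] -/
theorem det_gram_mul_det_kkt (e : ν ⊕ ι ≃ κ) (Δ : Matrix κ κ ℝ) (Q : Matrix ι κ ℝ) (C : Matrix κ ν ℝ)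
    (hQC : Q * C = 0) :
    (Cᵀ * C).det * (fromBlocks Δ Qᵀ Q 0).det =
      (-1) ^ Fintype.card ι * (Q * Qᵀ).det * (Cᵀ * Δ * C).det := by
  set Δ' : Matrix (ν ⊕ ι) (ν ⊕ ι) ℝ := Δ.submatrix e e with hΔ'
  set Q' : Matrix ι (ν ⊕ ι) ℝ := Q.submatrix id e with hQ'
  set C' : Matrix (ν ⊕ ι) ν ℝ := C.submatrix e id with hC'
  have hQC' : Q' * C' = 0 := by
    rw [hQ', hC', submatrix_mul_equiv, hQC, submatrix_zero, Pi.zero_apply, Pi.zero_apply]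
  have h := det_gram_mul_det_kkt_sum Δ' Q' C' hQC'
  have e1 : C'ᵀ * C' = Cᵀ * C := by
    rw [hC', transpose_submatrix, submatrix_mul_equiv, submatrix_id_id]
  have e2 : C'ᵀ * Δ' * C' = Cᵀ * Δ * C := by
    rw [hC', hΔ', transpose_submatrix, submatrix_mul_equiv, submatrix_mul_equiv, submatrix_id_id]
  have e3 : Q' * Q'ᵀ = Q * Qᵀ := by
    rw [hQ', transpose_submatrix, submatrix_mul_equiv, submatrix_id_id]
  have e4 : (fromBlocks Δ' Q'ᵀ Q' 0).det = (fromBlocks Δ Qᵀ Q 0).det := by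
    have : fromBlocks Δ' Q'ᵀ Q' 0 = (fromBlocks Δ Qᵀ Q 0).submatrix (Sum.map e id) (Sum.map e id) := by
      simp only [fromBlocks_submatrix_sum_map, hΔ', hQ', transpose_submatrix, submatrix_id_id]
    rw [this]
    exact det_submatrix_equiv_self (e.sumCongr (Equiv.refl ι)) (fromBlocks Δ Qᵀ Q 0)
  rw [e1, e2, e3, e4] at h
  exact h

/-- Logarithmic form: for `QC = 0` and `det(CᵀC), det(QQᵀ), det(CᵀΔC) ≠ 0`,
`log |det [[Δ,Qᵀ],[Q,0]]| = log det(QQᵀ) + log det(CᵀΔC) − log det(CᵀC)` (Mathlib's `Real.log x = Real.log |x|`). [folklore] -/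
theorem log_abs_det_kkt (e : ν ⊕ ι ≃ κ) (Δ : Matrix κ κ ℝ) (Q : Matrix ι κ ℝ) (C : Matrix κ ν ℝ)
    (hQC : Q * C = 0) (ha : (Cᵀ * C).det ≠ 0) (hg : (Q * Qᵀ).det ≠ 0) (hd : (Cᵀ * Δ * C).det ≠ 0) :
    Real.log |(fromBlocks Δ Qᵀ Q 0).det| =
      Real.log (Q * Qᵀ).det + Real.log (Cᵀ * Δ * C).det - Real.log (Cᵀ * C).det := by
  have h := det_gram_mul_det_kkt e Δ Q C hQC
  have hk : (fromBlocks Δ Qᵀ Q 0).det =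
      (-1) ^ Fintype.card ι * (Q * Qᵀ).det * (Cᵀ * Δ * C).det / (Cᵀ * C).det := by
    rw [eq_div_iff ha]
    linarith [h]
  rw [hk, abs_div, abs_mul, abs_mul, abs_pow, abs_neg, abs_one, one_pow, one_mul,
    Real.log_div (mul_ne_zero (abs_ne_zero.mpr hg) (abs_ne_zero.mpr hd)) (abs_ne_zero.mpr ha),
    Real.log_mul (abs_ne_zero.mpr hg) (abs_ne_zero.mpr hd), Real.log_abs, Real.log_abs, Real.log_abs]

/-- Nondegeneracy: for `QC = 0` with `det(CᵀC) ≠ 0` and `det(QQᵀ) ≠ 0`, the bordered matrix is nonsingular iff the reduced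
form `CᵀΔC` is. [folklore] -/
theorem kkt_det_ne_zero_iff (e : ν ⊕ ι ≃ κ) (Δ : Matrix κ κ ℝ) (Q : Matrix ι κ ℝ) (C : Matrix κ ν ℝ)
    (hQC : Q * C = 0) (ha : (Cᵀ * C).det ≠ 0) (hg : (Q * Qᵀ).det ≠ 0) :
    (fromBlocks Δ Qᵀ Q 0).det ≠ 0 ↔ (Cᵀ * Δ * C).det ≠ 0 := by
  have h := det_gram_mul_det_kkt e Δ Q C hQC
  have hs : ((-1 : ℝ) ^ Fintype.card ι) ≠ 0 := pow_ne_zero _ (by norm_num)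
  constructor
  · intro hk hd
    rw [hd, mul_zero] at h
    exact (mul_ne_zero ha hk) h
  · intro hd hk
    rw [hk, mul_zero] at h
    exact (mul_ne_zero (mul_ne_zero hs hg) hd) h.symm

/-- BASIS INDEPENDENCE of the reduced determinant up to the Gram factor: for two matrices `C₁, C₂ : κ × ν` with
`QC₁ = QC₂ = 0` and `det(QQᵀ) ≠ 0`, `det(C₁ᵀΔC₁)·det(C₂ᵀC₂) = det(C₂ᵀΔC₂)·det(C₁ᵀC₁)` — i.e. `det(CᵀΔC)/det(CᵀC)` does
not depend on the kernel parametrisation. [folklore] -/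
theorem det_reduced_mul_det_gram_eq (e : ν ⊕ ι ≃ κ) (Δ : Matrix κ κ ℝ) (Q : Matrix ι κ ℝ) (C₁ C₂ : Matrix κ ν ℝ)
    (h₁ : Q * C₁ = 0) (h₂ : Q * C₂ = 0) (hg : (Q * Qᵀ).det ≠ 0) :
    (C₁ᵀ * Δ * C₁).det * (C₂ᵀ * C₂).det = (C₂ᵀ * Δ * C₂).det * (C₁ᵀ * C₁).det := by
  have e₁ := det_gram_mul_det_kkt e Δ Q C₁ h₁
  have e₂ := det_gram_mul_det_kkt e Δ Q C₂ h₂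
  have hs : ((-1 : ℝ) ^ Fintype.card ι) ≠ 0 := pow_ne_zero _ (by norm_num)
  have key : (-1) ^ Fintype.card ι * (Q * Qᵀ).det *
      ((C₁ᵀ * Δ * C₁).det * (C₂ᵀ * C₂).det - (C₂ᵀ * Δ * C₂).det * (C₁ᵀ * C₁).det) = 0 := by
    linear_combination (C₁ᵀ * C₁).det * e₂ - (C₂ᵀ * C₂).det * e₁
  rcases mul_eq_zero.mp key with h | h
  · exact absurd h (mul_ne_zero hs hg)
  · exact sub_eq_zero.mp h

end Real

/-! ## §2. Over the landed objects of `Beta.OneLoop`: nondegeneracy and sign under `Regular` -/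

section Bridge

variable {n m r : ℕ}

/-- A matrix with surjective `mulVec` (onto) has injective `vecMul` (its transpose is injective): if `Qu = w` and
`wᵀQ = 0` then `‖w‖² = wᵀ(Qu) = (wᵀQ)u = 0`. [folklore] -/
theorem vecMul_injective_of_mulVec_surjective {p q : Type*} [Fintype p] [Fintype q] (Q : Matrix p q ℝ)
    (hQ : Function.Surjective Q.mulVec) : Function.Injective Q.vecMul := by
  intro w₁ w₂ h
  rw [← sub_eq_zero]
  have hw : (w₁ - w₂) ᵥ* Q = 0 := by
    rw [sub_vecMul, sub_eq_zero]
    exact h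
  obtain ⟨u, hu⟩ := hQ (w₁ - w₂)
  have : (w₁ - w₂) ⬝ᵥ (w₁ - w₂) = 0 := by
    calc (w₁ - w₂) ⬝ᵥ (w₁ - w₂) = (w₁ - w₂) ⬝ᵥ (Q *ᵥ u) := by rw [hu]
      _ = ((w₁ - w₂) ᵥ* Q) ⬝ᵥ u := dotProduct_mulVec _ _ _
      _ = 0 := by rw [hw, zero_dotProduct]
  exact dotProduct_self_eq_zero.mp this

/-- (a) NONDEGENERACY: under `Regular` (`Q` onto, `Δ > 0` on `ker Q`) the bordered matrix `[[Δ,Qᵀ],[Q,0]]` is nonsingular.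
Direct proof: if `Δv + Qᵀw = 0` and `Qv = 0` then `vᵀΔv = −(Qv)ᵀw = 0`, so `v = 0` by positivity on the kernel, then
`Qᵀw = 0` and `w = 0` because `Qᵀ` is injective. [folklore] -/
theorem kkt_det_ne_zero (Z : ConstrainedGaussian n m) (hZ : Z.Regular) : Z.kkt.det ≠ 0 := by
  intro hdet
  obtain ⟨x, hx0, hx⟩ := Matrix.exists_mulVec_eq_zero_iff.mpr hdet
  have hK : Sum.elim (Z.Δ *ᵥ (x ∘ Sum.inl) + Z.Qᵀ *ᵥ (x ∘ Sum.inr))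
      (Z.Q *ᵥ (x ∘ Sum.inl) + (0 : Matrix (Fin m) (Fin m) ℝ) *ᵥ (x ∘ Sum.inr)) = 0 := by
    rw [← fromBlocks_mulVec]
    exact hx
  set v : Fin n → ℝ := x ∘ Sum.inl with hv_def
  set w : Fin m → ℝ := x ∘ Sum.inr with hw_def
  have h1 : Z.Δ *ᵥ v + Z.Qᵀ *ᵥ w = 0 := by
    funext i
    have := congrFun hK (Sum.inl i)
    simpa using this
  have h2 : Z.Q *ᵥ v = 0 := by
    funext i
    have := congrFun hK (Sum.inr i)
    simpa using this
  have h3 : v ⬝ᵥ Z.Δ *ᵥ v = 0 := by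
    have : v ⬝ᵥ (Z.Δ *ᵥ v + Z.Qᵀ *ᵥ w) = 0 := by rw [h1, dotProduct_zero]
    rw [dotProduct_add, dotProduct_mulVec v Z.Qᵀ w, vecMul_transpose, h2, zero_dotProduct, add_zero] at this
    exact this
  have hv : v = 0 := by
    by_contra hv
    exact (lt_irrefl (0 : ℝ)) ((hZ.posKer v hv h2).trans_eq h3)
  have hw' : Z.Qᵀ *ᵥ w = 0 := by
    rw [hv, mulVec_zero, zero_add] at h1
    exact h1
  have hw : w = 0 := by
    apply vecMul_injective_of_mulVec_surjective Z.Q hZ.onto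
    show w ᵥ* Z.Q = 0 ᵥ* Z.Q
    rw [zero_vecMul, ← mulVec_transpose]
    exact hw'
  apply hx0
  funext i
  cases i with
  | inl i => exact congrFun hv i
  | inr i => exact congrFun hw i

/-- EXISTENCE OF A KERNEL PARAMETRISATION from `Q` onto (rank–nullity): an injective `C : n × (n − m)` with `QC = 0`
(its columns are a basis of `ker Q`), and `n − m + m = n`. [folklore] -/
theorem exists_kernelBasis (Q : Matrix (Fin m) (Fin n) ℝ) (hQ : Function.Surjective Q.mulVec) :
    ∃ C : Matrix (Fin n) (Fin (n - m)) ℝ, Q * C = 0 ∧ Function.Injective C.mulVec ∧ n - m + m = n := by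
  have hrange : LinearMap.range Q.mulVecLin = ⊤ := LinearMap.range_eq_top.mpr hQ
  have hdim : m + Module.finrank ℝ (LinearMap.ker Q.mulVecLin) = n := by
    have h := LinearMap.finrank_range_add_finrank_ker Q.mulVecLin
    rwa [hrange, finrank_top, Module.finrank_fin_fun, Module.finrank_fin_fun] at h
  have hr : Module.finrank ℝ (LinearMap.ker Q.mulVecLin) = n - m := by omega
  let b := Module.finBasisOfFinrankEq ℝ (LinearMap.ker Q.mulVecLin) hr
  let φ : (Fin (n - m) → ℝ) →ₗ[ℝ] (Fin n → ℝ) :=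
    (LinearMap.ker Q.mulVecLin).subtype ∘ₗ
      (b.equivFun.symm : (Fin (n - m) → ℝ) →ₗ[ℝ] LinearMap.ker Q.mulVecLin)
  refine ⟨LinearMap.toMatrix' φ, ?_, ?_, by omega⟩
  · have hcomp : Matrix.toLin' Q ∘ₗ φ = 0 := by
      apply LinearMap.ext
      intro w
      change Q *ᵥ ((b.equivFun.symm w : LinearMap.ker Q.mulVecLin) : Fin n → ℝ) = 0
      exact LinearMap.mem_ker.mp (b.equivFun.symm w).2
    calc Q * LinearMap.toMatrix' φ
        = LinearMap.toMatrix' (Matrix.toLin' Q) * LinearMap.toMatrix' φ := by rw [LinearMap.toMatrix'_toLin']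
      _ = LinearMap.toMatrix' (Matrix.toLin' Q ∘ₗ φ) := (LinearMap.toMatrix'_comp _ _).symm
      _ = 0 := by rw [hcomp, map_zero]
  · have hφ : Function.Injective φ := by
      intro w₁ w₂ h
      apply b.equivFun.symm.injective
      apply Subtype.ext
      exact h
    intro w₁ w₂ h
    apply hφ
    rwa [← LinearMap.toMatrix'_mulVec φ w₁, ← LinearMap.toMatrix'_mulVec φ w₂]

/-- `CᵀC` is positive definite for an injective real `C` (Mathlib's `PosDef.conjTranspose_mul_self`, real form). [folklore] -/
theorem gram_posDef {p q : Type*} [Fintype p] [Fintype q] [DecidableEq q] (C : Matrix p q ℝ)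
    (hC : Function.Injective C.mulVec) : (Cᵀ * C).PosDef := by
  have h := Matrix.PosDef.conjTranspose_mul_self C hC
  rwa [conjTranspose_eq_transpose_of_trivial] at h

/-- `QQᵀ` is positive definite for `Q` onto (Mathlib's `PosDef.mul_conjTranspose_self`, real form). [folklore] -/
theorem constraintGram_posDef {p q : Type*} [Fintype p] [Fintype q] [DecidableEq p] (Q : Matrix p q ℝ)
    (hQ : Function.Surjective Q.mulVec) : (Q * Qᵀ).PosDef := by
  have h := Matrix.PosDef.mul_conjTranspose_self Q (vecMul_injective_of_mulVec_surjective Q hQ)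
  rwa [conjTranspose_eq_transpose_of_trivial] at h

/-- The reduced form `CᵀΔC` ([Balaban1985BackgroundPropagators] (3.158): «a positive definite operator C*Δ_kC» — here a
THEOREM of the model, not a quotation used as a fact) is positive definite for `Δ` symmetric and positive on `ker Q`,
`QC = 0`, `C` injective.  (The `Regular`-hypothesis form is pv16's `GaussianIntegral.posDef_reduced`, landed first; this is
the `Q`-onto-free variant, stated here so that this module stays UPSTREAM of `Beta/GaussianIntegral`, which is to import
`kkt_det_ne_zero` from here.) [folklore] -/
theorem reduced_posDef (Z : ConstrainedGaussian n m) (C : Matrix (Fin n) (Fin r) ℝ) (hsymm : Z.Δ.IsSymm)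
    (hpos : ∀ v : Fin n → ℝ, v ≠ 0 → Z.Q.mulVec v = 0 → 0 < v ⬝ᵥ Z.Δ.mulVec v)
    (hQC : Z.Q * C = 0) (hC : Function.Injective C.mulVec) : (Z.reduced C).PosDef := by
  refine Matrix.PosDef.of_dotProduct_mulVec_pos ?_ fun x hx => ?_
  · show (Z.reduced C)ᴴ = Z.reduced C
    rw [conjTranspose_eq_transpose_of_trivial]
    exact Z.reduced_isSymm C hsymm
  · have hCx : C *ᵥ x ≠ 0 := fun h => hx (hC (by rw [h, mulVec_zero]))
    have hQCx : Z.Q *ᵥ (C *ᵥ x) = 0 := by rw [mulVec_mulVec, hQC, zero_mulVec]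
    have h := hpos (C *ᵥ x) hCx hQCx
    rw [star_trivial]
    show 0 < x ⬝ᵥ (Cᵀ * Z.Δ * C) *ᵥ x
    rw [← mulVec_mulVec, ← mulVec_mulVec, dotProduct_mulVec, vecMul_transpose]
    exact h

/-- The Gram form for the landed objects: for `Z : ConstrainedGaussian n m` and ANY `C : n × r` with `Z.Q·C = 0`,
`r + m = n`:  `det(CᵀC) · det Z.kkt = (−1)^m · det(Z.Q Z.Qᵀ) · det(Z.reduced C)`, unconditionally. [folklore] -/
theorem det_gram_mul_kkt_det (Z : ConstrainedGaussian n m) (C : Matrix (Fin n) (Fin r) ℝ) (hr : r + m = n)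
    (hQC : Z.Q * C = 0) :
    (Cᵀ * C).det * Z.kkt.det = (-1) ^ m * (Z.Q * Z.Qᵀ).det * (Z.reduced C).det := by
  have h := det_gram_mul_det_kkt (finSumFinEquiv.trans (finCongr hr)) Z.Δ Z.Q C hQC
  rw [Fintype.card_fin] at h
  exact h

/-- (c) THE SIGN of the bordered determinant under `Regular`: `0 < (−1)^m · det [[Δ,Qᵀ],[Q,0]]` (choose an injective kernel
parametrisation `C` by `exists_kernelBasis`; `det(CᵀC), det(QQᵀ), det(CᵀΔC) > 0`; apply the Gram form).  Equivalently
`|det K| = (−1)^m det K`. [folklore] -/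
theorem neg_one_pow_mul_kkt_det_pos (Z : ConstrainedGaussian n m) (hZ : Z.Regular) :
    0 < (-1) ^ m * Z.kkt.det := by
  obtain ⟨C, hQC, hC, hr⟩ := exists_kernelBasis Z.Q hZ.onto
  have hid := det_gram_mul_kkt_det Z C hr hQC
  have ha : 0 < (Cᵀ * C).det := (gram_posDef C hC).det_pos
  have hg : 0 < (Z.Q * Z.Qᵀ).det := (constraintGram_posDef Z.Q hZ.onto).det_pos
  have hd : 0 < (Z.reduced C).det := (reduced_posDef Z C hZ.symm hZ.posKer hQC hC).det_pos
  have hs : ((-1 : ℝ) ^ m) * (-1) ^ m = 1 := by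
    rw [← mul_pow]
    norm_num
  have key : (-1) ^ m * Z.kkt.det = (Z.Q * Z.Qᵀ).det * (Z.reduced C).det / (Cᵀ * C).det := by
    rw [eq_div_iff ha.ne']
    calc (-1) ^ m * Z.kkt.det * (Cᵀ * C).det = (-1) ^ m * ((Cᵀ * C).det * Z.kkt.det) := by ring
      _ = (-1) ^ m * ((-1) ^ m * (Z.Q * Z.Qᵀ).det * (Z.reduced C).det) := by rw [hid]
      _ = ((-1 : ℝ) ^ m * (-1) ^ m) * ((Z.Q * Z.Qᵀ).det * (Z.reduced C).det) := by ring
      _ = (Z.Q * Z.Qᵀ).det * (Z.reduced C).det := by rw [hs, one_mul]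
  rw [key]
  exact div_pos (mul_pos hg hd) ha

/-- `|det Z.kkt| = (−1)^m · det Z.kkt` under `Regular`. [folklore] -/
theorem abs_kkt_det (Z : ConstrainedGaussian n m) (hZ : Z.Regular) : |Z.kkt.det| = (-1) ^ m * Z.kkt.det := by
  have h := neg_one_pow_mul_kkt_det_pos Z hZ
  rcases neg_one_pow_eq_or ℝ m with hm | hm
  · rw [hm, one_mul] at h ⊢
    exact abs_of_pos h
  · rw [hm, neg_one_mul] at h ⊢
    exact abs_of_neg (neg_pos.mp h)

/-! ## §3. The exact Jacobian between `logZ` and `logZred` (basis-free Gram form) -/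

/-- (b) THE EXACT JACOBIAN in Gram form: for `Z : ConstrainedGaussian n m`, any `C : n × r` with `Z.Q·C = 0`, `r + m = n`,
and `det(CᵀC), det(QQᵀ), det(CᵀΔC) ≠ 0`:
`Z.logZ = Z.logZred C + ½·log det(CᵀC) − ½·log det(Z.Q Z.Qᵀ)`.
The correction depends on `(Q, C)` only, not on `Δ`; for `C` with orthonormal columns it is `−½·log det(QQᵀ)`.
(OBJECTS.md §4: «the two differ by a ½log det-type Jacobian of the elimination, background-dependent in general».) [folklore] -/
theorem logZ_eq_logZred_add (Z : ConstrainedGaussian n m) (C : Matrix (Fin n) (Fin r) ℝ) (hr : r + m = n)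
    (hQC : Z.Q * C = 0) (ha : (Cᵀ * C).det ≠ 0) (hg : (Z.Q * Z.Qᵀ).det ≠ 0) (hd : (Z.reduced C).det ≠ 0) :
    Z.logZ = Z.logZred C + (1 / 2 : ℝ) * Real.log (Cᵀ * C).det - (1 / 2 : ℝ) * Real.log (Z.Q * Z.Qᵀ).det := by
  have hlog := log_abs_det_kkt (finSumFinEquiv.trans (finCongr hr)) Z.Δ Z.Q C hQC ha hg hd
  have hnm : ((n : ℝ) - m) = r := by
    have : ((r : ℕ) : ℝ) + m = n := by exact_mod_cast hr
    linarith
  unfold ConstrainedGaussian.logZ ConstrainedGaussian.logZred ConstrainedGaussian.kkt ConstrainedGaussian.reduced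
  rw [hlog, hnm]
  ring

/-- (b′) Under `Regular`, for EVERY injective kernel parametrisation `C` (`Z.Q·C = 0`, `r + m = n`) the three determinants are
positive and `Z.logZ = Z.logZred C + ½·log det(CᵀC) − ½·log det(Z.Q Z.Qᵀ)`. [folklore] -/
theorem logZ_eq_logZred_add_of_regular (Z : ConstrainedGaussian n m) (hZ : Z.Regular) (C : Matrix (Fin n) (Fin r) ℝ)
    (hr : r + m = n) (hQC : Z.Q * C = 0) (hC : Function.Injective C.mulVec) :
    Z.logZ = Z.logZred C + (1 / 2 : ℝ) * Real.log (Cᵀ * C).det - (1 / 2 : ℝ) * Real.log (Z.Q * Z.Qᵀ).det :=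
  logZ_eq_logZred_add Z C hr hQC (gram_posDef C hC).det_pos.ne' (constraintGram_posDef Z.Q hZ.onto).det_pos.ne'
    (reduced_posDef Z C hZ.symm hZ.posKer hQC hC).det_pos.ne'

/-- BASIS INDEPENDENCE over the landed objects: for two matrices `C₁, C₂ : n × r` with `Z.Q·Cᵢ = 0`, `r + m = n` and
`det(Z.Q Z.Qᵀ) ≠ 0`:  `det(Z.reduced C₁)·det(C₂ᵀC₂) = det(Z.reduced C₂)·det(C₁ᵀC₁)`. [folklore] -/
theorem det_reduced_mul_det_gram_eq' (Z : ConstrainedGaussian n m) (C₁ C₂ : Matrix (Fin n) (Fin r) ℝ) (hr : r + m = n)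
    (h₁ : Z.Q * C₁ = 0) (h₂ : Z.Q * C₂ = 0) (hg : (Z.Q * Z.Qᵀ).det ≠ 0) :
    (Z.reduced C₁).det * (C₂ᵀ * C₂).det = (Z.reduced C₂).det * (C₁ᵀ * C₁).det :=
  det_reduced_mul_det_gram_eq (finSumFinEquiv.trans (finCongr hr)) Z.Δ Z.Q C₁ C₂ h₁ h₂ hg

/-! ## §4. Consequence for the one-loop polarization: background-independent constraint ⇒ the fixed-`C`
parametrisation has the same Hessian -/

/-- Adding a constant does not change an iterated Fréchet derivative of positive order (no differentiability needed:
`fderiv (f + c) = fderiv f` pointwise). [folklore] -/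
private theorem iteratedFDeriv_succ_add_const {E : Type*} [NormedAddCommGroup E] [NormedSpace ℝ E]
    (f : E → ℝ) (c : ℝ) (k : ℕ) (x : E) :
    iteratedFDeriv ℝ (k + 1) (fun y => f y + c) x = iteratedFDeriv ℝ (k + 1) f x := by
  rw [iteratedFDeriv_succ_eq_comp_right, iteratedFDeriv_succ_eq_comp_right]
  simp only [Function.comp_apply, fderiv_add_const]

/-- Order-two instance of `iteratedFDeriv_succ_add_const`. [folklore] -/
private theorem iteratedFDeriv_two_add_const {E : Type*} [NormedAddCommGroup E] [NormedSpace ℝ E]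
    (f : E → ℝ) (c : ℝ) (x : E) :
    iteratedFDeriv ℝ 2 (fun y => f y + c) x = iteratedFDeriv ℝ 2 f x :=
  iteratedFDeriv_succ_add_const f c 1 x

/-- The Jacobian as a function of the background, for a family whose CONSTRAINT DOES NOT MOVE (`(F B).Q = Q₀`) and a
fixed `C` with `Q₀C = 0`, `r + m = n`, all three determinants nondegenerate along the family:
`F.logZ = F.logZred C + (½·log det(CᵀC) − ½·log det(Q₀Q₀ᵀ))` — a `B`-INDEPENDENT constant. [folklore] -/
theorem family_logZ_eq_logZred_add_const {ι : Type*} (F : Family ι n m) (C : Matrix (Fin n) (Fin r) ℝ)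
    (Q₀ : Matrix (Fin m) (Fin n) ℝ) (hr : r + m = n) (hQ : ∀ B, (F B).Q = Q₀) (hQC : Q₀ * C = 0)
    (ha : (Cᵀ * C).det ≠ 0) (hg : (Q₀ * Q₀ᵀ).det ≠ 0) (hd : ∀ B, ((F B).reduced C).det ≠ 0) :
    F.logZ = fun B => F.logZred C B +
      ((1 / 2 : ℝ) * Real.log (Cᵀ * C).det - (1 / 2 : ℝ) * Real.log (Q₀ * Q₀ᵀ).det) := by
  funext B
  have hB := logZ_eq_logZred_add (F B) C hr (by rw [hQ B]; exact hQC) ha (by rw [hQ B]; exact hg) (hd B)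
  rw [hQ B] at hB
  show (F B).logZ = (F B).logZred C + _
  rw [hB]
  ring

/-- (e) BACKGROUND-INDEPENDENT CONSTRAINT ⇒ `Π⁰` MAY BE COMPUTED FROM THE REDUCED FORM.  For a background family `F`
with `(F B).Q = Q₀` for all `B`, a fixed `C : n × r` with `Q₀·C = 0`, `r + m = n`, `det(CᵀC) ≠ 0`, `det(Q₀Q₀ᵀ) ≠ 0` and
`det((F B).reduced C) ≠ 0` for all `B`:  `polarization F i j = hessianAt (F.logZred C) i j` for all `i, j` — the Jacobian
`½·log det(CᵀC) − ½·log det(Q₀Q₀ᵀ)` is a `B`-independent constant and drops out of the second derivative (no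
differentiability hypothesis: `iteratedFDeriv ℝ 2 (f + const) = iteratedFDeriv ℝ 2 f` identically).  If `Q̃` moves with
the background the constant becomes `B`-dependent and this equality is NOT asserted (OBJECTS.md §5(a), G-beta-1). [folklore] -/
theorem polarization_eq_hessianAt_logZred {ι : Type*} [Fintype ι] [DecidableEq ι] (F : Family ι n m)
    (C : Matrix (Fin n) (Fin r) ℝ) (Q₀ : Matrix (Fin m) (Fin n) ℝ) (hr : r + m = n) (hQ : ∀ B, (F B).Q = Q₀)
    (hQC : Q₀ * C = 0) (ha : (Cᵀ * C).det ≠ 0) (hg : (Q₀ * Q₀ᵀ).det ≠ 0) (hd : ∀ B, ((F B).reduced C).det ≠ 0)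
    (i j : ι) :
    polarization F i j = hessianAt (F.logZred C) i j := by
  unfold polarization hessianAt
  rw [family_logZ_eq_logZred_add_const F C Q₀ hr hQ hQC ha hg hd, iteratedFDeriv_two_add_const]

/-- LOCAL version matching the `regular` field of `OneLoopDictionary` (v1.2: `∀ᶠ B in 𝓝 0, (model k t B).Regular`):
if the constraint does not move (`(F B).Q = Q₀`), `C` is an injective kernel parametrisation of `Q₀` with `r + m = n`, and
`F B` is `Regular` for `B` near `0`, then `F.logZ =ᶠ[𝓝 0] F.logZred C + (½·log det(CᵀC) − ½·log det(Q₀Q₀ᵀ))`. [folklore] -/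
theorem family_logZ_eventuallyEq_of_regular {ι : Type*} (F : Family ι n m) (C : Matrix (Fin n) (Fin r) ℝ)
    (Q₀ : Matrix (Fin m) (Fin n) ℝ) (hr : r + m = n) (hQ : ∀ B, (F B).Q = Q₀) (hQC : Q₀ * C = 0)
    (hC : Function.Injective C.mulVec) (hreg : ∀ᶠ B in nhds 0, (F B).Regular) :
    F.logZ =ᶠ[nhds 0] fun B => F.logZred C B +
      ((1 / 2 : ℝ) * Real.log (Cᵀ * C).det - (1 / 2 : ℝ) * Real.log (Q₀ * Q₀ᵀ).det) := by
  filter_upwards [hreg] with B hB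
  have h := logZ_eq_logZred_add_of_regular (F B) hB C hr (by rw [hQ B]; exact hQC) hC
  rw [hQ B] at h
  show (F B).logZ = (F B).logZred C + _
  rw [h]
  ring

/-- (e′) THE SAME CONSEQUENCE UNDER THE DICTIONARY'S HYPOTHESES: constraint independent of the background, `C` an injective
kernel parametrisation of `Q₀`, `r + m = n`, `F B` `Regular` near `B = 0` ⇒ `polarization F i j = hessianAt (F.logZred C) i j`
(second derivatives at `0` only see the germ at `0`). [folklore] -/
theorem polarization_eq_hessianAt_logZred_of_regular {ι : Type*} [Fintype ι] [DecidableEq ι] (F : Family ι n m)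
    (C : Matrix (Fin n) (Fin r) ℝ) (Q₀ : Matrix (Fin m) (Fin n) ℝ) (hr : r + m = n) (hQ : ∀ B, (F B).Q = Q₀)
    (hQC : Q₀ * C = 0) (hC : Function.Injective C.mulVec) (hreg : ∀ᶠ B in nhds 0, (F B).Regular) (i j : ι) :
    polarization F i j = hessianAt (F.logZred C) i j := by
  have hev := family_logZ_eventuallyEq_of_regular F C Q₀ hr hQ hQC hC hreg
  unfold polarization hessianAt
  rw [(hev.iteratedFDeriv ℝ 2).eq_of_nhds, iteratedFDeriv_two_add_const]

/-- Under the same hypotheses the `C²`-regularity at `0` (the `smooth` field of `OneLoopDictionary` v1.2) transfers between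
the bordered and the reduced normalisation: `ContDiffAt ℝ k F.logZ 0 ↔ ContDiffAt ℝ k (F.logZred C) 0`. [folklore] -/
theorem contDiffAt_logZ_iff_logZred_of_regular {ι : Type*} [Fintype ι] (F : Family ι n m)
    (C : Matrix (Fin n) (Fin r) ℝ) (Q₀ : Matrix (Fin m) (Fin n) ℝ) (hr : r + m = n) (hQ : ∀ B, (F B).Q = Q₀)
    (hQC : Q₀ * C = 0) (hC : Function.Injective C.mulVec) (hreg : ∀ᶠ B in nhds 0, (F B).Regular) (k : WithTop ℕ∞) :
    ContDiffAt ℝ k F.logZ 0 ↔ ContDiffAt ℝ k (F.logZred C) 0 := by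
  have hev := family_logZ_eventuallyEq_of_regular F C Q₀ hr hQ hQC hC hreg
  constructor
  · intro h
    have h1 := h.congr_of_eventuallyEq hev.symm
    have h2 := h1.sub (contDiffAt_const :
      ContDiffAt ℝ k (fun _ : ι → ℝ => (1 / 2 : ℝ) * Real.log (Cᵀ * C).det - (1 / 2 : ℝ) * Real.log (Q₀ * Q₀ᵀ).det) 0)
    simpa using h2
  · intro h
    exact (h.add contDiffAt_const).congr_of_eventuallyEq hev

/-! ## §5. Dictionary with pv03-g3's adapted-coordinates Jacobian: at Bałaban's `C`, `|det Q_κ|² = det(QQᵀ)/det(CᵀC)` -/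

/-- Bałaban's elimination matrix lies in the kernel of the constraint in the ORIGINAL coordinates:
`Q · (Z.elimMatrix e) = 0` whenever `det Q_κ ≠ 0` (transport of `ConstraintElimination.constraint_mul_elim` along the
adapted splitting `e`). [folklore] -/
theorem Q_mul_elimMatrix (Z : ConstrainedGaussian n m) (e : Fin n ≃ Fin r ⊕ Fin m)
    (hκ : (Z.constraintEliminated e).det ≠ 0) : Z.Q * Z.elimMatrix e = 0 := by
  have hQ : Z.Q = (fromCols (Z.constraintRetained e) (Z.constraintEliminated e)).submatrix id e := by
    rw [← ConstrainedGaussian.reindex_Q_eq_fromCols]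
    simp [reindex_apply, submatrix_submatrix]
  rw [hQ, ConstrainedGaussian.elimMatrix, submatrix_mul_equiv,
    ConstraintElimination.constraint_mul_elim _ _ (isUnit_iff_ne_zero.mpr hκ), submatrix_zero, Pi.zero_apply,
    Pi.zero_apply]

/-- Bałaban's elimination matrix is injective (it is the identity on the retained coordinates:
`ConstraintElimination.elim_mulVec_inl`). [folklore] -/
theorem elimMatrix_mulVec_injective (Z : ConstrainedGaussian n m) (e : Fin n ≃ Fin r ⊕ Fin m) :
    Function.Injective (Z.elimMatrix e).mulVec := by
  intro v w h
  have h' : Z.elimMatrix e *ᵥ v = Z.elimMatrix e *ᵥ w := h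
  have h1 : ∀ u : Fin r → ℝ, ∀ s : Fin r, (Z.elimMatrix e *ᵥ u) (e.symm (Sum.inl s)) = u s := by
    intro u s
    have : (Z.elimMatrix e *ᵥ u) (e.symm (Sum.inl s)) =
        (ConstraintElimination.elim (Z.constraintRetained e) (Z.constraintEliminated e) *ᵥ u)
          (e (e.symm (Sum.inl s))) := rfl
    rw [this, Equiv.apply_symm_apply, ConstraintElimination.elim_mulVec_inl]
  funext s
  have := congrFun h' (e.symm (Sum.inl s))
  rwa [h1, h1] at this

/-- DICTIONARY at the determinant level: for Bałaban's `C = Z.elimMatrix e` in an adapted splitting with `det Q_κ ≠ 0`,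
`det(CᵀC) · (det Q_κ)² = det(QQᵀ)` — pv03-g3's local Jacobian `|det Q_κ|` (`ConstrainedGaussian.logZ_eq_logZred_sub_log`)
and the basis-free Gram Jacobian `(det(QQᵀ)/det(CᵀC))^{1/2}` of `logZ_eq_logZred_add` are the same number.  Proof: the
identity does not involve `Δ`; compare `det_gram_mul_kkt_det` and `ConstrainedGaussian.det_kkt_eq_of_adapted` on the
auxiliary model `⟨Q, 1⟩`. [folklore] -/
theorem det_gram_elimMatrix_mul_sq (Z : ConstrainedGaussian n m) (e : Fin n ≃ Fin r ⊕ Fin m)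
    (hκ : (Z.constraintEliminated e).det ≠ 0) :
    ((Z.elimMatrix e)ᵀ * Z.elimMatrix e).det * (Z.constraintEliminated e).det ^ 2 = (Z.Q * Z.Qᵀ).det := by
  have hr : r + m = n := (ConstrainedGaussian.eq_add_of_adapted e).symm
  have hQC := Q_mul_elimMatrix Z e hκ
  have ha : ((Z.elimMatrix e)ᵀ * Z.elimMatrix e).det ≠ 0 :=
    (gram_posDef _ (elimMatrix_mulVec_injective Z e)).det_pos.ne'
  have hs : ((-1 : ℝ) ^ m) ≠ 0 := pow_ne_zero _ (by norm_num)
  have h1 : ((Z.elimMatrix e)ᵀ * Z.elimMatrix e).det * (ConstrainedGaussian.kkt ⟨Z.Q, 1⟩).det =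
      (-1) ^ m * (Z.Q * Z.Qᵀ).det * ((Z.elimMatrix e)ᵀ * Z.elimMatrix e).det := by
    have h := det_gram_mul_kkt_det (⟨Z.Q, 1⟩ : ConstrainedGaussian n m) (Z.elimMatrix e) hr hQC
    have hred : ConstrainedGaussian.reduced (⟨Z.Q, 1⟩ : ConstrainedGaussian n m) (Z.elimMatrix e) =
        (Z.elimMatrix e)ᵀ * Z.elimMatrix e := by
      show (Z.elimMatrix e)ᵀ * (1 : Matrix (Fin n) (Fin n) ℝ) * Z.elimMatrix e = _
      rw [Matrix.mul_one]
    rw [hred] at h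
    exact h
  have h2 : (ConstrainedGaussian.kkt ⟨Z.Q, 1⟩).det =
      (-1) ^ m * ((Z.elimMatrix e)ᵀ * Z.elimMatrix e).det * (Z.constraintEliminated e).det ^ 2 := by
    have h := ConstrainedGaussian.det_kkt_eq_of_adapted (⟨Z.Q, 1⟩ : ConstrainedGaussian n m) e hκ
    have hred : ConstrainedGaussian.reduced (⟨Z.Q, 1⟩ : ConstrainedGaussian n m)
          (ConstrainedGaussian.elimMatrix ⟨Z.Q, 1⟩ e) = (Z.elimMatrix e)ᵀ * Z.elimMatrix e := by
      show (Z.elimMatrix e)ᵀ * (1 : Matrix (Fin n) (Fin n) ℝ) * Z.elimMatrix e = _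
      rw [Matrix.mul_one]
    rw [hred] at h
    exact h
  rw [h2] at h1
  apply mul_left_cancel₀ (mul_ne_zero hs ha)
  linear_combination h1

/-- DICTIONARY in logarithmic form: at Bałaban's `C = Z.elimMatrix e` (`det Q_κ ≠ 0`),
`log |det Q_κ| = ½·log det(QQᵀ) − ½·log det(CᵀC)` — so `logZ_eq_logZred_add` specialises to pv03-g3's
`Z.logZ = Z.logZred C − log|det Q_κ|` and conversely. [folklore] -/
theorem log_abs_det_constraintEliminated_eq (Z : ConstrainedGaussian n m) (e : Fin n ≃ Fin r ⊕ Fin m)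
    (hκ : (Z.constraintEliminated e).det ≠ 0) :
    Real.log |(Z.constraintEliminated e).det| =
      (1 / 2 : ℝ) * Real.log (Z.Q * Z.Qᵀ).det - (1 / 2 : ℝ) * Real.log ((Z.elimMatrix e)ᵀ * Z.elimMatrix e).det := by
  have h := det_gram_elimMatrix_mul_sq Z e hκ
  have ha : 0 < ((Z.elimMatrix e)ᵀ * Z.elimMatrix e).det :=
    (gram_posDef _ (elimMatrix_mulVec_injective Z e)).det_pos
  have hq : 0 < (Z.constraintEliminated e).det ^ 2 := by
    rw [← sq_abs]
    exact pow_pos (abs_pos.mpr hκ) 2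
  rw [← h, Real.log_mul ha.ne' hq.ne', Real.log_pow, ← Real.log_abs ((Z.constraintEliminated e).det)]
  push_cast
  ring

end Bridge

end Literature.MathematicalPhysics.QuantumFieldTheory.Balaban1983to89.Beta.KKTBridge
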